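import Summits.ResolutionOfSingularities.ResolutionOfSingularities.Theorems.FrobeniusClosingPatchingRelPerfectDepthLegalPieceOracle
import Summits.ResolutionOfSingularities.ResolutionOfSingularities.Theorems.FrobeniusClosingPatchingRelPerfectDepthLegalOracleEntry
import Summits.ResolutionOfSingularities.ResolutionOfSingularities.Theorems.FrobeniusClosingPatchingRelPerfectDepthLegalPieceInclusion
import Summits.ResolutionOfSingularities.ResolutionOfSingularities.Theorems.FrobeniusClosingPatchingRelPerfectDepthFlagLegalPhaseTwo
import Summits.ResolutionOfSingularities.ResolutionOfSingularities.Theorems.FrobeniusClosingPatchingRelPerfectDepthWeightedSeqTransport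
import HarnessLib

/-!
# Crux `PatchingRelPerfect` (stmt-ResolutionOfSingularities-16161), chain W5.2 — T6-E1b residual `LegalScopedDivisorReduction₃`,
# PHASE 2 closer (2b), D7: `LegalPhaseTwo₃` FROM F-32bR — the fact-light SURFACE-TRACE SEPARATION GAME, assembled

[OURS · L1 W5.2 · res-D-pv-052 g6 for the (2b) D7 closer, BY NAME from res-L1-w52-lead-1's `ORACLE-HANDOFF.md` (873ae9ed5877222f) §O4
and `PHASE2-STEPB-SPEC.md` D5–D7] Replaces the role of NO printed item; NOT a statement of the manuscript under review.  The ONLY named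
fact consumed is F-32bR `CossartJannsenSaito2020EmbeddedSequenceB` (Cossart–Jannsen–Saito 2020, Thm. 1.4 in boundary form), through
res-L1-w52-stub-1's STEP A (`DepthLegal.HostState.stepA`, embedded resolution of the TRACE CURVE of the boundary on the regular host
surface); everything else is fact-free.

THE COMPOSITION (`DepthTargets.legalPhaseTwo₃_of_cjsB`): from a `HostBoundary₃` state `H = D · M` on an integral Noetherian regular
excellent threefold (`FlagState₃`):
ENTRY (res-D-pv-054 `HostState.of_stateIn` + `filter_pos`; the curve clause by res-D-pv-016's `one_lt_coheight_of_stateIn`) →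
STEP A (res-L1-w52-stub-1 `HostState.stepA`, pure weight two) → the oracle's entry invariant `Inv₃` on the whole host
(`HostState.exists_sncd_trace_of_stepA_end`, …DepthLegalOracleEntry) → SPLIT the regular host into its irreducible components
(`Kollar2007.boundaryPieces`, `prod_pieceIdeals_eq_of_isRegular`; `Inv₃` per component by …DepthLegalPieceInclusion) →
COMPONENT LOOP (`pieces_loop`, induction on the number of waiting components): the active component runs res-L1-w52-lead-1's curve-move
loop `curve_loop (Inv₄ k) (curveOracle₄ k)` (…DepthLegalLoop / …DepthLegalOracle / …DepthLegalPieceOracle) until its trace is trivial,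
then joins the done components and the next waiting component is activated (integral: irreducible and reduced; its trace non-zero since a
strict normal crossings divisor is a proper subset) → EXIT (res-L1-w52-lead-1 `exists_snc_support_hosts`: pairwise disjoint regular
hypersurfaces, each off the positive boundary, ++ the snc boundary) → `FlagState₃` clauses by `IsPureWeightedSeq.transport`.
Hence **`LegalPhaseTwo₃` holds modulo F-32bR alone** — a second, F-72-free closer of PHASE 2 of the residual `LegalScopedDivisorReduction₃`
(the first being res-D-pv-016's `legalPhaseTwo₃_of_oldBoundary` ∘ `oldBoundaryResolution₃_of_F72`).

AI-written; AI review is weaker than expert review.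

## References
* V. Cossart, U. Jannsen, S. Saito, *Desingularization: invariants and strategy*, LNM 2270 (2020), Thm. 1.4, Def. 4.1. [CossartJannsenSaito2020]
* J. Kollár, *Lectures on Resolution of Singularities* (2007), 3.104 Step 2.1, (3.111) Step 3. [Kollar2007]
* E. Bierstone, D. Grigoriev, P. Milman, J. Włodarczyk, arXiv:1206.3090, Def. 3.1.1, §4 Step 2. [BierstoneGrigorievMilmanWlodarczyk2011]
* The Stacks Project, Tags 0357, 02OS. [StacksProject]
-/

-- `Summit.<Summit>.<Sub>.Theorems` with `Sub = Summit` (single-conjunct summit, D-0017)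
set_option linter.dupNamespace false

noncomputable section

open CategoryTheory CategoryTheory.Limits AlgebraicGeometry TopologicalSpace IsLocalRing
open Literature.AlgebraicGeometry.Resolution Scheme.IdealSheafData

namespace Summit.ResolutionOfSingularities.ResolutionOfSingularities.Theorems

universe u

namespace DepthLegal

open WeightTwoB DepthTargets

/-! ## §1 The exit and the activation bookkeeping -/

namespace HostStateN

variable {E : Scheme.{u}} [IsLocallyNoetherian E] {H N D : E.IdealSheafData} {L : List (E.IdealSheafData × ℕ)}
  (S : HostStateN H N D L)

omit [IsLocallyNoetherian E] in
/-- A host with TRIVIAL trace misses every positive-exponent boundary member (`M ≤ F`). [folklore] -/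
theorem disjoint_of_trace_eq_top (hpos : ∀ p ∈ L, 0 < p.2) (htop : (monomialIdeal L).comap D.subschemeι = ⊤) :
    ∀ p ∈ L, 0 < p.2 → Disjoint (D.support : Set E) p.1.support := by
  intro p hp _
  rw [Set.disjoint_left]
  intro x hxD hxp
  have hx : x ∈ Set.range D.subschemeι.base := by rw [Scheme.IdealSheafData.range_subschemeι]; exact hxD
  obtain ⟨s, rfl⟩ := hx
  have h1 : s ∈ ((monomialIdeal L).comap D.subschemeι).support := by
    refine support_antitone (Scheme.IdealSheafData.comap_mono (f := D.subschemeι)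
      (monomialIdeal_le_of_mem_boundaryOf hpos (fst_mem_boundaryOf hp))) ?_
    exact (mem_support_comap_iff D.subschemeι p.1 s).mpr hxp
  rw [htop, Scheme.IdealSheafData.support_top] at h1
  exact h1

include S in
/-- [OURS · L1 W5.2] **THE EXIT** (spec D5, `SncSupport` shape): when every host component is done — the active one with trivial trace, the
others in the inert factor `N = ∏ done`, pairwise disjoint regular hypersurfaces off the positive boundary — `Supp H` lies in a strict normal
crossings divisor (res-L1-w52-lead-1's `exists_snc_support_hosts`). [cite: BierstoneGrigorievMilmanWlodarczyk2011, Def. 3.1.1] -/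
theorem exists_sncd_support_of_done (hpos : ∀ p ∈ L, 0 < p.2) (done : List E.IdealSheafData) (hN : N = done.prod)
    (hpw : (D :: done).Pairwise fun G G' => Disjoint (G.support : Set E) G'.support) (hdone : ∀ G ∈ done, DonePiece D L G)
    (htop : (monomialIdeal L).comap D.subschemeι = ⊤) :
    ∃ B : Set E, IsStrictNormalCrossingsDivisor E B ∧ (H.support : Set E) ⊆ B := by
  have hfac : H = (N * D) * monomialIdeal L := by rw [S.fac, mul_assoc]
  refine exists_snc_support_hosts S.regE hfac S.sncB (D :: done) ?_ ?_ hpw ?_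
  · -- `Supp (N · D) ⊆ ⋃ (D :: done)`
    intro x hx
    rw [SetLike.mem_coe, Scheme.IdealSheafData.support_mul] at hx
    simp only [Set.mem_iUnion, List.mem_cons, exists_prop]
    rcases hx with hx | hx
    · rw [hN] at hx
      have hx' : x ∈ ((done.prod).support : Set E) := hx
      rw [IdealSheafData.coe_support_prod] at hx'
      simp only [Set.mem_iUnion, exists_prop] at hx'
      obtain ⟨G, hG, hxG⟩ := hx'
      exact ⟨G, Or.inr hG, hxG⟩
    · exact ⟨D, Or.inl rfl, hx⟩
  · -- order-one generators
    intro G hG x hx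
    rcases List.mem_cons.mp hG with rfl | hG
    · exact S.hostHyp x hx
    · obtain ⟨-, hreg, hcart, -⟩ := hdone G hG
      exact exists_generator_not_mem_sq S.regE hcart hreg hx
  · -- off the positive boundary
    intro G hG p hp hp0
    rcases List.mem_cons.mp hG with rfl | hG
    · exact disjoint_of_trace_eq_top hpos htop p hp hp0
    · exact (hdone G hG).sep p hp hp0

end HostStateN

/-! ## §2 The component loop -/

/-- The trace of the boundary monomial on a host component carrying `Inv₃` is NOT the zero ideal: a strict normal crossings divisor of an
integral scheme is a proper subset. [cite: StacksProject, Tag 0BI9] -/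
theorem trace_ne_bot_of_sncd {E : Scheme.{u}} {G : E.IdealSheafData} [IsIntegral G.subscheme] [IsLocallyNoetherian G.subscheme]
    {L : List (E.IdealSheafData × ℕ)}
    (h : ∃ BX : Set G.subscheme, IsStrictNormalCrossingsDivisor G.subscheme BX ∧
      (((monomialIdeal L).comap G.subschemeι).support : Set G.subscheme) ⊆ BX) :
    (monomialIdeal L).comap G.subschemeι ≠ ⊥ := by
  obtain ⟨BX, hBX, hsub⟩ := h
  intro h0
  apply DepthOne.coe_ne_univ_of_isEffectiveCartier_vanishingIdeal hBX.isEffectiveCartier_vanishingIdeal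
  refine Set.eq_univ_of_univ_subset ?_
  rw [h0, Scheme.IdealSheafData.support_bot] at hsub
  exact hsub

/-- [OURS · L1 W5.2] **THE COMPONENT LOOP**: from a `HostStateN` with integral active host, positive exponents, `Inv₄ k` and non-zero trace,
a pure weight-two sequence reaches a state whose ideal has support in a strict normal crossings divisor (induction on the number `k` of
waiting components: res-L1-w52-lead-1's `curve_loop` on the active component, then activation of the next one, finally the exit).
[cite: Kollar2007, (3.111) Step 3] [cite: CossartJannsenSaito2020, Thm. 1.4] -/
theorem pieces_loop (k : ℕ) :
    ∀ {E : Scheme.{u}} [IsIntegral E] [IsNoetherian E] {E₀ : Scheme.{u}} {ρ : E ⟶ E₀} {H₀ : E₀.IdealSheafData}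
      {H N D : E.IdealSheafData} {L : List (E.IdealSheafData × ℕ)}
      (_ : HostStateN H N D L) (_ : IsIntegral D.subscheme), (∀ p ∈ L, 0 < p.2) → Inv₄ k H N D L →
      (monomialIdeal L).comap D.subschemeι ≠ ⊥ → IsPureWeightedSeq 2 ρ H₀ H →
      ∃ (E' : Scheme.{u}) (_ : IsIntegral E') (_ : IsNoetherian E') (ρ' : E' ⟶ E₀) (H' : E'.IdealSheafData),
        IsPureWeightedSeq 2 ρ' H₀ H' ∧ ∃ B : Set E', IsStrictNormalCrossingsDivisor E' B ∧ (H'.support : Set E') ⊆ B := by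
  induction k with
  | zero =>
    intro E _ _ E₀ ρ H₀ H N D L S hXint hpos hInv hT hseq
    have hdisj : Disjoint (N.support : Set E) D.support := by
      obtain ⟨-, -, ⟨todo, done, -, hN, -, htodo, hdone⟩⟩ := hInv
      rw [hN, disjoint_support_list_prod_iff]
      intro G hG
      rcases List.mem_append.mp hG with hG | hG
      · exact (htodo G hG).disj
      · exact (hdone G hG).disj
    haveI := hXint
    haveI : AlgebraicGeometry.IsNoetherian D.subscheme := isNoetherian_subscheme D
    obtain ⟨E', hI', hN', ρ', H', N', D', L', hseq', S', hint', hpos', hInv', -, htop'⟩ :=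
      curve_loop (@Inv₄ 0) (curveOracle₄ 0)
        (∑ y ∈ (finite_divisorialPoints hT).toFinset, (idealOrder ((monomialIdeal L).comap D.subschemeι) y).toNat)
        S hXint hpos hInv hdisj hT (fun _ => le_rfl)
    haveI := hI'
    haveI := hN'
    obtain ⟨-, -, ⟨todo', done', hlen', hN'eq, hpw', -, hdone'⟩⟩ := hInv'
    have htodo' : todo' = [] := List.eq_nil_of_length_eq_zero hlen'
    subst htodo'
    rw [List.nil_append] at hN'eq hpw'
    have hpw'' : (D' :: done').Pairwise fun G G' => Disjoint (G.support : Set E') G'.support :=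
      List.pairwise_cons.mpr ⟨fun G hG => (hdone' G hG).disj.symm, hpw'⟩
    obtain ⟨B, hB, hHB⟩ := S'.exists_sncd_support_of_done hpos' done' hN'eq hpw'' hdone' htop'
    exact ⟨E', hI', hN', ρ' ≫ ρ, H', DepthCleanup.pureWeightedSeq_append hseq' hseq, B, hB, hHB⟩
  | succ k ih =>
    intro E _ _ E₀ ρ H₀ H N D L S hXint hpos hInv hT hseq
    have hdisj : Disjoint (N.support : Set E) D.support := by
      obtain ⟨-, -, ⟨todo, done, -, hN, -, htodo, hdone⟩⟩ := hInv
      rw [hN, disjoint_support_list_prod_iff]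
      intro G hG
      rcases List.mem_append.mp hG with hG | hG
      · exact (htodo G hG).disj
      · exact (hdone G hG).disj
    haveI := hXint
    haveI : AlgebraicGeometry.IsNoetherian D.subscheme := isNoetherian_subscheme D
    obtain ⟨E', hI', hN', ρ', H', N', D', L', hseq', S', hint', hpos', hInv', -, htop'⟩ :=
      curve_loop (@Inv₄ (k + 1)) (curveOracle₄ (k + 1))
        (∑ y ∈ (finite_divisorialPoints hT).toFinset, (idealOrder ((monomialIdeal L).comap D.subschemeι) y).toNat)
        S hXint hpos hInv hdisj hT (fun _ => le_rfl)
    haveI := hI'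
    haveI := hN'
    obtain ⟨-, hdim', ⟨todo', done', hlen', hN'eq, hpw', htodo', hdone'⟩⟩ := hInv'
    obtain ⟨G, rest, rfl⟩ := List.exists_of_length_succ todo' hlen'
    -- the next component `G` and its clauses
    obtain ⟨hGD, hGreg, hGcart, hGirr, hGrad, hGInv⟩ := htodo' G List.mem_cons_self
    have hD'pos : ∀ p ∈ L', 0 < p.2 → Disjoint (D'.support : Set E') p.1.support :=
      HostStateN.disjoint_of_trace_eq_top hpos' htop'
    have hall : ∀ G'' ∈ rest ++ done', Disjoint (G''.support : Set E') D'.support := by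
      intro G'' hG''
      rcases List.mem_append.mp hG'' with h | h
      · exact (htodo' G'' (List.mem_cons_of_mem _ h)).disj
      · exact (hdone' G'' h).disj
    -- ACTIVATE `G`: the done host `D'` joins the inert factor
    have Snew : HostStateN H' ((rest ++ (done' ++ [D'])).prod) G L' :=
      { regE := S'.regE
        fac := by
          rw [S'.fac, hN'eq]
          simp only [List.cons_append, List.prod_cons, List.prod_append, List.prod_nil, mul_one, mul_assoc, mul_comm,
            mul_left_comm]
        hostCartier := hGcart
        hostHyp := fun x hx => exists_generator_not_mem_sq S'.regE hGcart hGreg hx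
        sncB := S'.sncB }
    haveI hGint : IsIntegral G.subscheme := by
      rw [hGrad]; exact isIntegral_subscheme_vanishingIdeal_piece hGirr
    haveI : IsLocallyNoetherian G.subscheme := LocallyOfFiniteType.isLocallyNoetherian G.subschemeι
    have hTG : (monomialIdeal L').comap G.subschemeι ≠ ⊥ := trace_ne_bot_of_sncd hGInv
    have hInvnew : Inv₄ k H' ((rest ++ (done' ++ [D'])).prod) G L' := by
      refine ⟨hGInv, hdim', rest, done' ++ [D'], by simpa using hlen', rfl, ?_, ?_, ?_⟩
      · -- pairwise disjointness
        rw [← List.append_assoc, List.pairwise_append]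
        refine ⟨hpw'.sublist (List.sublist_cons_self _ _), List.pairwise_singleton _ _, ?_⟩
        intro a ha b hb
        rw [List.mem_singleton] at hb
        subst hb
        exact hall a ha
      · -- waiting components (their clauses do not see the active host, except disjointness)
        intro G'' hG''
        obtain ⟨-, h2, h3, h4, h5, h6⟩ := htodo' G'' (List.mem_cons_of_mem _ hG'')
        have hpw0 := List.pairwise_cons.mp hpw'
        exact ⟨(hpw0.1 G'' (List.mem_append.mpr (Or.inl hG''))).symm, h2, h3, h4, h5, h6⟩
      · -- done components
        intro G'' hG''
        rcases List.mem_append.mp hG'' with h | h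
        · obtain ⟨-, h2, h3, h4⟩ := hdone' G'' h
          have hpw0 := List.pairwise_cons.mp hpw'
          exact ⟨(hpw0.1 G'' (List.mem_append.mpr (Or.inr h))).symm, h2, h3, h4⟩
        · rw [List.mem_singleton] at h
          subst h
          exact ⟨hGD.symm, S'.toHostState.isRegular_host, S'.hostCartier, hD'pos⟩
    obtain ⟨E'', hI'', hN'', ρ'', H'', hseq'', B, hB, hHB⟩ :=
      ih Snew hGint hpos' hInvnew hTG (DepthCleanup.pureWeightedSeq_append hseq' hseq)
    exact ⟨E'', hI'', hN'', ρ'', H'', hseq'', B, hB, hHB⟩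

/-! ## §3 Entry: STEP A on the whole host, then the components -/

/-- [OURS · L1 W5.2] **PHASE 2 IN CONTENT, from F-32bR**: from `HostBoundary₃`-data on an integral Noetherian excellent threefold of
dimension `≤ 3` there is a pure weight-two sequence to a state whose ideal has support in a strict normal crossings divisor
(module docstring: ENTRY → STEP A → `Inv₃` → SPLIT → COMPONENT LOOP → EXIT). [cite: CossartJannsenSaito2020, Thm. 1.4, Def. 4.1]
[cite: Kollar2007, (3.111) Step 3] -/
theorem exists_sncSupport_of_cjsB (hCJS : CossartJannsenSaito2020EmbeddedSequenceB.{u}) {E : Scheme.{u}} [IsIntegral E] [IsNoetherian E]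
    (hexc : Scheme.IsExcellent E) (hdim : topologicalKrullDim E ≤ 3) {H : E.IdealSheafData} (hhb : HostBoundary₃ E H) :
    ∃ (E' : Scheme.{u}) (_ : IsIntegral E') (_ : IsNoetherian E') (ρ : E' ⟶ E) (H' : E'.IdealSheafData),
      IsPureWeightedSeq 2 ρ H H' ∧ ∃ B : Set E', IsStrictNormalCrossingsDivisor E' B ∧ (H'.support : Set E') ⊆ B := by
  classical
  obtain ⟨D, ℬ, S, hDreg⟩ := hhb
  -- ENTRY: positive exponents, curve clause
  have S₀ : HostState H D (ℬ.filter fun p => decide (0 < p.2)) := (HostState.of_stateIn S hDreg).filter_pos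
  have hcurve₀ : ∀ x ∈ D.support, x ∈ (monomialIdeal (ℬ.filter fun p => decide (0 < p.2))).support → 1 < Order.coheight x := by
    intro x hxD hxM
    rw [DepthSNC.monomialIdeal_filter_pos] at hxM
    obtain ⟨p, hp, -, hxp⟩ := DepthHostLaw.exists_mem_support_of_mem_support_monomialIdeal hxM
    exact one_lt_coheight_of_stateIn S hxD hp hxp
  -- STEP A (F-32bR)
  obtain ⟨E₁, hI₁, hN₁, ρ₁, H₁, D₁, L₁, S₁, hseq₁, -, hdim₁, hcurve₁, Z₁, hNZ₁, e, X₁, B₁, hX₁c, -, -, -, hB₁, htr, hU, hL⟩ :=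
    S₀.stepA hCJS (IsPureWeightedSeq.nil H) hexc hdim hcurve₀
  haveI := hI₁
  haveI := hN₁
  haveI := hNZ₁
  -- `Inv₃` on the whole host, positive exponents
  have hInv₁ : ∃ BX : Set D₁.subscheme, IsStrictNormalCrossingsDivisor D₁.subscheme BX ∧
      (((monomialIdeal (L₁.filter fun p => decide (0 < p.2))).comap D₁.subschemeι).support : Set D₁.subscheme) ⊆ BX := by
    rw [DepthSNC.monomialIdeal_filter_pos]
    exact S₁.exists_sncd_trace_of_stepA_end hcurve₁ e hX₁c hB₁ htr hU hL
  have S₁' : HostState H₁ D₁ (L₁.filter fun p => decide (0 < p.2)) := S₁.filter_pos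
  have hpos₁ : ∀ p ∈ (L₁.filter fun p => decide (0 < p.2)), 0 < p.2 := fun p hp => pos_of_mem_filter_pos hp
  set L₁' := L₁.filter fun p => decide (0 < p.2) with hL₁'
  -- SPLIT the regular host into its irreducible components
  have hD₁reg : Scheme.IsRegular D₁.subscheme := S₁.isRegular_host
  set Zs := Kollar2007.boundaryPieces D₁ with hZs
  have hP : IsPiecePartition D₁ Zs := isPiecePartition_boundaryPieces_of_isRegular hD₁reg
  have hprod : (pieceIdeals Zs).prod = D₁ := prod_pieceIdeals_eq_of_isRegular hD₁reg hP
  -- the clauses of every component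
  have hpiece : ∀ Z ∈ Zs, Scheme.IsRegular (vanishingIdeal Z).subscheme ∧ IsEffectiveCartier (vanishingIdeal Z) ∧
      IsIrreducible ((vanishingIdeal Z).support : Set E₁) ∧ vanishingIdeal Z = vanishingIdeal (vanishingIdeal Z).support ∧
      ∃ BX : Set (vanishingIdeal Z).subscheme, IsStrictNormalCrossingsDivisor (vanishingIdeal Z).subscheme BX ∧
        (((monomialIdeal L₁').comap (vanishingIdeal Z).subschemeι).support : Set (vanishingIdeal Z).subscheme) ⊆ BX := by
    intro Z hZ
    have hsupp : (vanishingIdeal Z).support = Z := SetLike.coe_injective (Scheme.IdealSheafData.coe_support_vanishingIdeal Z)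
    have hmem : vanishingIdeal Z ∈ pieceIdeals Zs := List.mem_map.mpr ⟨Z, hZ, rfl⟩
    have hcart : IsEffectiveCartier (vanishingIdeal Z) := by
      have h := List.prod_erase hmem
      rw [hprod] at h
      exact (h ▸ S₁.hostCartier).of_mul_left
    refine ⟨isRegular_subscheme_vanishingIdeal_piece hD₁reg hP hZ, hcart, ?_, by rw [hsupp], exists_sncd_trace_piece hD₁reg hP hZ _ hInv₁⟩
    rw [hsupp]; exact isIrreducible_of_mem_boundaryPieces hZ
  -- no component: `D₁ = ⊤`, exit at once; else run the component loop
  rcases hZs' : Zs with _ | ⟨Z, rest⟩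
  · have hD₁ : D₁ = ⊤ := by rw [← hprod, hZs', pieceIdeals, List.map_nil, List.prod_nil, Scheme.IdealSheafData.one_eq_top]
    have hfac : H₁ = D₁ * monomialIdeal L₁' := S₁'.fac
    obtain ⟨B, hB, hHB⟩ := exists_snc_support_hosts S₁'.regE hfac S₁'.sncB [] (by
        rw [hD₁, Scheme.IdealSheafData.support_top]; intro x hx; exact absurd hx (by simp)) (by simp) List.Pairwise.nil (by simp)
    exact ⟨E₁, hI₁, hN₁, ρ₁, H₁, hseq₁, B, hB, hHB⟩
  · -- activate the first component
    have hZmem : Z ∈ Zs := by rw [hZs']; exact List.mem_cons_self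
    obtain ⟨hG₀reg, hG₀cart, hG₀irr, hG₀rad, hG₀Inv⟩ := hpiece Z hZmem
    have hpwall : (pieceIdeals Zs).Pairwise fun (P Q : E₁.IdealSheafData) => Disjoint (P.support : Set E₁) Q.support :=
      pieceIdeals_pairwise_disjoint_support hP
    rw [hZs'] at hpwall
    have hpw0 := List.pairwise_cons.mp hpwall
    have Snew : HostStateN H₁ (pieceIdeals rest).prod (vanishingIdeal Z) L₁' :=
      { regE := S₁'.regE
        fac := by
          have h1 : D₁ = vanishingIdeal Z * (pieceIdeals rest).prod := by
            rw [← hprod, hZs', pieceIdeals, List.map_cons, List.prod_cons]; rfl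
          rw [S₁'.fac, h1, mul_assoc, mul_left_comm]
        hostCartier := hG₀cart
        hostHyp := fun x hx => exists_generator_not_mem_sq S₁'.regE hG₀cart hG₀reg hx
        sncB := S₁'.sncB }
    haveI hG₀int : IsIntegral (vanishingIdeal Z).subscheme := isIntegral_subscheme_vanishingIdeal_piece (isIrreducible_of_mem_boundaryPieces hZmem)
    haveI : IsLocallyNoetherian (vanishingIdeal Z).subscheme := LocallyOfFiniteType.isLocallyNoetherian (vanishingIdeal Z).subschemeι
    have hTG₀ : (monomialIdeal L₁').comap (vanishingIdeal Z).subschemeι ≠ ⊥ := trace_ne_bot_of_sncd hG₀Inv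
    have hInv₄ : Inv₄ rest.length H₁ (pieceIdeals rest).prod (vanishingIdeal Z) L₁' := by
      refine ⟨hG₀Inv, hdim₁, pieceIdeals rest, [], by rw [pieceIdeals, List.length_map], by rw [List.append_nil], ?_, ?_,
        fun _ h => absurd h List.not_mem_nil⟩
      · rw [List.append_nil]; exact hpw0.2
      · intro G hG
        obtain ⟨Z', hZ', rfl⟩ := List.mem_map.mp hG
        have hZ'mem : Z' ∈ Zs := by rw [hZs']; exact List.mem_cons_of_mem _ hZ'
        obtain ⟨h1, h2, h3, h4, h5⟩ := hpiece Z' hZ'mem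
        exact ⟨(hpw0.1 _ hG).symm, h1, h2, h3, h4, h5⟩
    obtain ⟨E₂, hI₂, hN₂, ρ₂, H₂, hseq₂, B, hB, hHB⟩ := pieces_loop rest.length Snew hG₀int hpos₁ hInv₄ hTG₀ hseq₁
    exact ⟨E₂, hI₂, hN₂, ρ₂, H₂, hseq₂, B, hB, hHB⟩

end DepthLegal

/-! ## §4 The closer BY NAME -/

namespace DepthTargets

/-- [OURS · L1 W5.2] **`LegalPhaseTwo₃` FROM F-32bR ALONE** — PHASE 2 («make the support snc, legally») of the residual
`LegalScopedDivisorReduction₃`, closed by the fact-light surface-trace separation game (2b) of res-L1-w52-lead-1's plan: the composition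
`DepthLegal.exists_sncSupport_of_cjsB` with the `FlagState₃` clauses transported along the pure weight-two sequence.  CONDITIONAL on the
ONE named fact F-32bR (`CossartJannsenSaito2020EmbeddedSequenceB`, hypothesis); nothing of the manuscript under review is used.
[cite: CossartJannsenSaito2020, Thm. 1.4] [cite: Kollar2007, (3.111) Step 3] -/
theorem legalPhaseTwo₃_of_cjsB (hCJS : CossartJannsenSaito2020EmbeddedSequenceB.{u}) : LegalPhaseTwo₃.{u} := by
  intro E _ H hfs hhb
  obtain ⟨hint, hnoeth, hreg, hexc, hdim, hne, hlp, -⟩ := hfs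
  haveI := hint
  obtain ⟨E', hI', hN', ρ, H', hseq, B, hB, hHB⟩ := DepthLegal.exists_sncSupport_of_cjsB hCJS hexc hdim.le hhb
  obtain ⟨hint', hnoeth', hreg', hne', -, hlp', hexc', hdim', -⟩ := hseq.transport (by norm_num) hreg hne
  exact ⟨E', ρ, H', hseq, ⟨hint', hnoeth', hreg', hexc' hexc, hdim' 3 hdim, hne', hlp' hlp, le_rfl⟩, B, hB, hHB⟩

end DepthTargets

end Summit.ResolutionOfSingularities.ResolutionOfSingularities.Theorems

end
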